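import Summits.MatrixMultiplication.MatrixMultiplication.Theorems.RectangularThmB.Negative.SkewUSPFamilies
import Mathlib.Analysis.SpecialFunctions.Pow.Real
import Mathlib.Analysis.SpecialFunctions.Exp

/-!
# `RectangularThmB` (crux stmt-MatrixMultiplication-10597, route ThinBlockAlpha):
# no bound `η(ℓ,a) ≥ c·a` uniform in `ℓ` — multi-block thin STPP designs in Lean

Negative-side support file of the crux disprover (cdisprove seat); `sorry`-free.  The crux asks for
`η(ℓ,a) > 0` with `L·N^{2+η} < |H|` for every exponent-`≤ ℓ` abelian STPP family of thin blocks
`⟨N,M,N⟩`, `N^a ≤ M`.  One block gives `η(ℓ,a) ≤ a` (`LoadBearing.lean`); here the skew local strong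
USP families of `SkewUSPFamilies.lean`, pushed through CKSU Thm 33 (tree
`CohnKleinbergSzegedyUmans2005_thm33_holds`), give genuinely multi-block thin designs:

* `card_filter_support_eq` — the CKSU cardinality bookkeeping
  `#{x ∈ Cyc_ℓ^k : x_j ≠ 0 ↔ row a j = c} = (ℓ-1)^{#\{j : row a j = c\}}` (also what the support
  item `USPToBounded` needs).
* `not_uniform_half_a` — `ℓ = 16`, `a = 1/5`: `cyc11` in `Cyc₁₆^{11}` gives `L = 11` blocks
  `⟨15⁵, 15, 15⁵⟩` with `16^{11} ≤ 11·(15⁵)^{2+1/10}` (two-leg exponent `0.0754…`): the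
  strengthening `∀ ℓ ∀ a ∈ (0,1), Inner ℓ a (a/2)` is FALSE.
* `not_uniform_linear_eta` — for EVERY `c > 0`, `∀ ℓ ∀ a ∈ (0,1), Inner ℓ a (c·a)` is FALSE:
  `cycRow n` in `Cyc_{2n+1}^{2n+1}` (`L = 2n+1` blocks `⟨(2n)ⁿ, 2n, (2n)ⁿ⟩`, `a = 1/n`) has
  `(2n+1)^{2n+1} ≤ (2n+1)(2n)^{2n}·e ≤ L·N^{2+c/n}` once `2n ≥ e^{1/c}`; so `η(ℓ,a)/a → 0` along
  `ℓ → ∞`, `a = 2/(ℓ-1)` (rate `≤ (1+o(1))/ln ℓ`): any proof of the crux must let `η/a` degenerate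
  with `ℓ`.

Details and the calibration table: `Cruxes/RectangularThmB/Disproof.lean`.
-/

namespace Summit.MatrixMultiplication.MatrixMultiplication.Theorems.RectangularThmB.Negative

open Literature.Computability.AlgebraicComplexity

noncomputable section

/-- Counting lemma for the CKSU sets: the vectors of `Cyc_ℓ^k` whose support is exactly a
prescribed coordinate set `{j | row a j = c}` number `(ℓ - 1)^{#\{j | row a j = c\}}`. -/
theorem card_filter_support_eq (ℓ : ℕ) [NeZero ℓ] {k L : ℕ} (row : Fin L → Fin k → Fin 3)
    (a : Fin L) (c : Fin 3) :
    (Finset.univ.filter fun x : Fin k → ZMod ℓ => ∀ j, x j ≠ 0 ↔ row a j = c).card =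
      (ℓ - 1) ^ (Finset.univ.filter fun j => row a j = c).card := by
  classical
  have hset : (Finset.univ.filter fun x : Fin k → ZMod ℓ => ∀ j, x j ≠ 0 ↔ row a j = c) =
      Fintype.piFinset fun j => if row a j = c then Finset.univ.filter (· ≠ 0) else {0} := by
    ext x
    simp only [Finset.mem_filter, Finset.mem_univ, true_and, Fintype.mem_piFinset]
    constructor
    · intro h j
      by_cases hj : row a j = c
      · simp only [hj, ↓reduceIte, Finset.mem_filter, Finset.mem_univ, true_and]
        exact (h j).2 hj
      · simp only [hj, ↓reduceIte, Finset.mem_singleton]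
        by_contra hx
        exact hj ((h j).1 hx)
    · intro h j
      have hj := h j
      by_cases hc : row a j = c
      · simp only [hc, ↓reduceIte, Finset.mem_filter, Finset.mem_univ, true_and] at hj
        exact ⟨fun _ => hc, fun _ => hj⟩
      · simp only [hc, ↓reduceIte, Finset.mem_singleton] at hj
        simp [hj, hc]
  have hne : (Finset.univ.filter fun y : ZMod ℓ => y ≠ 0).card = ℓ - 1 := by
    rw [Finset.filter_ne' Finset.univ (0 : ZMod ℓ), Finset.card_erase_of_mem (Finset.mem_univ _),
      Finset.card_univ, ZMod.card]
  rw [hset, Fintype.card_piFinset]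
  simp only [apply_ite Finset.card, hne, Finset.card_singleton]
  rw [Finset.prod_ite, Finset.prod_const, Finset.prod_const, one_pow, mul_one]

/-- **`η(ℓ,a) ≥ a/2` uniformly in `ℓ` is false.**  Witness: `ℓ = 16`, `a = 1/5`, the STPP family of
CKSU Thm 33 over the cyclic skew local strong USP `cyc11` in `Cyc₁₆^{11}`: `L = 11` blocks
`⟨15⁵, 15, 15⁵⟩`, `|H| = 16^{11} ≤ 11 · (15⁵)^{2.1}` (indeed `= 11·(15⁵)^{2.0754…}`).  Compare
`eta_le_a` in `LoadBearing.lean` (one block: `η ≤ a`): multi-block designs DO beat the one-block bound by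
constant factors; any proof of the crux must let `η/a` depend on `ℓ`. -/
theorem not_uniform_half_a : ¬ ∀ ℓ : ℕ, ∀ a : ℝ, 0 < a → a < 1 →
    ∀ (H : Type) [AddCommGroup H] [Fintype H], AddMonoid.exponent H ≤ ℓ →
      ∀ (L N M : ℕ) (A B C : Fin L → Finset H), IsSTPP A B C →
        (∀ i, (A i).card = N ∧ (B i).card = M ∧ (C i).card = N) → 2 ≤ N → (N : ℝ) ^ a ≤ M →
          (L : ℝ) * (N : ℝ) ^ (2 + a / 2) < Fintype.card H := by
  intro h
  have hI := h 16 (1 / 5) (by norm_num) (by norm_num)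
  -- the design
  have hU := cyc11_isLocalStrongUSP
  have hS : IsSTPP (uspA 16 cyc11) (uspB 16 cyc11) (uspC 16 cyc11) :=
    CohnKleinbergSzegedyUmans2005_thm33_holds 16 11 11 cyc11 hU
  have hcard : ∀ i, (uspA 16 cyc11 i).card = 15 ^ 5 ∧ (uspB 16 cyc11 i).card = 15 ∧
      (uspC 16 cyc11 i).card = 15 ^ 5 := by
    intro i
    obtain ⟨h0, h1, h2⟩ := cyc11_counts i
    refine ⟨?_, ?_, ?_⟩
    · rw [uspA, card_filter_support_eq 16 cyc11 i 0, h0]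
    · rw [uspB, card_filter_support_eq 16 cyc11 i 1, h1]; rfl
    · rw [uspC, card_filter_support_eq 16 cyc11 i 2, h2]
  have hexp : AddMonoid.exponent (Fin 11 → ZMod 16) ≤ 16 := by
    have h16 : ∀ x : ZMod 16, 16 • x = 0 := by decide
    apply Nat.le_of_dvd (by norm_num)
    apply AddMonoid.exponent_dvd_of_forall_nsmul_eq_zero
    intro g
    funext j
    exact h16 (g j)
  have key := hI (Fin 11 → ZMod 16) hexp 11 (15 ^ 5) 15 _ _ _ hS hcard (by norm_num) ?_
  · -- contradiction with 11 · (15⁵)^{2.1} ≥ 16^{11}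
    have hH : (Fintype.card (Fin 11 → ZMod 16) : ℝ) = (16 : ℝ) ^ 11 := by
      rw [Fintype.card_fun, ZMod.card, Fintype.card_fin]; norm_num
    rw [hH] at key
    have hN : ((15 ^ 5 : ℕ) : ℝ) = 759375 := by norm_num
    rw [hN] at key
    have hsplit : (759375 : ℝ) ^ (2 + 1 / 5 / 2 : ℝ) = (759375 : ℝ) ^ 2 * (759375 : ℝ) ^ (1 / 10 : ℝ) := by
      rw [show (2 + 1 / 5 / 2 : ℝ) = 2 + 1 / 10 by norm_num, Real.rpow_add (by norm_num), Real.rpow_two]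
    rw [hsplit] at key
    -- 759375^{1/10} ≥ 3.87 since 3.87^10 ≤ 759375
    have hroot : (3.87 : ℝ) ≤ (759375 : ℝ) ^ (1 / 10 : ℝ) := by
      have h10 : ((3.87 : ℝ) ^ (10 : ℕ)) ^ ((10 : ℕ) : ℝ)⁻¹ = 3.87 :=
        Real.pow_rpow_inv_natCast (by norm_num) (by norm_num)
      have hle : (3.87 : ℝ) ^ (10 : ℕ) ≤ 759375 := by norm_num
      have := Real.rpow_le_rpow (by positivity) hle (by norm_num : (0 : ℝ) ≤ ((10 : ℕ) : ℝ)⁻¹)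
      rw [h10] at this
      convert this using 2
      all_goals norm_num
    push_cast at key
    nlinarith [hroot, key]
  · -- N^a ≤ M : (15⁵)^{1/5} = 15
    have : (((15 ^ 5 : ℕ)) : ℝ) ^ (1 / 5 : ℝ) = 15 := by
      push_cast
      have h := Real.pow_rpow_inv_natCast (show (0 : ℝ) ≤ 15 by norm_num) (show (5 : ℕ) ≠ 0 by norm_num)
      convert h using 2
      all_goals norm_num
    rw [this]
    push_cast
    exact le_rfl

/-! ### The asymptotic conclusion: no bound `η(ℓ,a) ≥ c·a` uniform in `ℓ` -/

/-- **No linear lower bound on `η` uniform in `ℓ`.**  For every `c > 0` the strengthening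
`∀ ℓ ∀ a ∈ (0,1), Inner ℓ a (c·a)` of the crux is false: the cyclic family in `Cyc_{2n+1}^{2n+1}`
(`L = 2n+1` blocks `⟨(2n)ⁿ, 2n, (2n)ⁿ⟩`, `a = 1/n`, exponent `2n+1`) has
`|H| = (2n+1)^{2n+1} ≤ (2n+1)·(2n)^{2n}·e ≤ L · N^{2 + c/n}` as soon as `2n ≥ e^{1/c}`.  So along
`ℓ → ∞`, `a = 2/(ℓ-1)`: `η(ℓ,a)/a ≤ (1+o(1))/ln ℓ → 0`. -/
theorem not_uniform_linear_eta (c : ℝ) (hc : 0 < c) :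
    ¬ ∀ ℓ : ℕ, ∀ a : ℝ, 0 < a → a < 1 →
      ∀ (H : Type) [AddCommGroup H] [Fintype H], AddMonoid.exponent H ≤ ℓ →
        ∀ (L N M : ℕ) (A B C : Fin L → Finset H), IsSTPP A B C →
          (∀ i, (A i).card = N ∧ (B i).card = M ∧ (C i).card = N) → 2 ≤ N → (N : ℝ) ^ a ≤ M →
            (L : ℝ) * (N : ℝ) ^ (2 + c * a) < Fintype.card H := by
  intro h
  obtain ⟨n, hn5, hnc⟩ : ∃ n : ℕ, 5 ≤ n ∧ Real.exp (1 / c) ≤ n := by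
    refine ⟨max 5 ⌈Real.exp (1 / c)⌉₊, le_max_left _ _, ?_⟩
    exact (Nat.le_ceil _).trans (by exact_mod_cast le_max_right _ _)
  have hn0 : n ≠ 0 := by omega
  have hnpos : (0 : ℝ) < n := by exact_mod_cast Nat.pos_of_ne_zero hn0
  have hI := h (2 * n + 1) (1 / n) (by positivity)
    (by rw [div_lt_one hnpos]; exact_mod_cast (show 1 < n by omega))
  -- the design in Cyc_{2n+1}^{2n+1}
  have hU := cycRow_isLocalStrongUSP hn5
  have hS : IsSTPP (uspA (2 * n + 1) (cycRow n)) (uspB (2 * n + 1) (cycRow n))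
      (uspC (2 * n + 1) (cycRow n)) :=
    CohnKleinbergSzegedyUmans2005_thm33_holds (2 * n + 1) (2 * n + 1) (2 * n + 1) (cycRow n) hU
  have hcard : ∀ i, (uspA (2 * n + 1) (cycRow n) i).card = (2 * n) ^ n ∧
      (uspB (2 * n + 1) (cycRow n) i).card = 2 * n ∧
      (uspC (2 * n + 1) (cycRow n) i).card = (2 * n) ^ n := by
    intro i
    refine ⟨?_, ?_, ?_⟩
    · rw [uspA, card_filter_support_eq (2 * n + 1) (cycRow n) i 0, card_cycRow_zero hn5 i,
        Nat.add_sub_cancel]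
    · rw [uspB, card_filter_support_eq (2 * n + 1) (cycRow n) i 1, card_cycRow_one i,
        Nat.add_sub_cancel, pow_one]
    · rw [uspC, card_filter_support_eq (2 * n + 1) (cycRow n) i 2, card_cycRow_two hn5 i,
        Nat.add_sub_cancel]
  have hexp : AddMonoid.exponent (Fin (2 * n + 1) → ZMod (2 * n + 1)) ≤ 2 * n + 1 := by
    apply Nat.le_of_dvd (by omega)
    apply AddMonoid.exponent_dvd_of_forall_nsmul_eq_zero
    intro g
    funext j
    show (2 * n + 1) • g j = 0
    rw [nsmul_eq_mul, ZMod.natCast_self, zero_mul]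
  have hN2 : 2 ≤ (2 * n) ^ n := le_trans (by omega) (Nat.le_self_pow hn0 (2 * n))
  have hx : (0 : ℝ) < 2 * n := by positivity
  have key := hI (Fin (2 * n + 1) → ZMod (2 * n + 1)) hexp (2 * n + 1) ((2 * n) ^ n) (2 * n)
    _ _ _ hS hcard hN2 ?_
  · -- contradiction
    have hH : (Fintype.card (Fin (2 * n + 1) → ZMod (2 * n + 1)) : ℝ) = (2 * n + 1 : ℝ) ^ (2 * n + 1) := by
      rw [Fintype.card_fun, ZMod.card, Fintype.card_fin]; push_cast; ring
    rw [hH] at key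
    have hNpow : (((2 * n) ^ n : ℕ) : ℝ) ^ (2 + c * (1 / n)) = (2 * n : ℝ) ^ (2 * n) * (2 * n : ℝ) ^ c := by
      push_cast
      rw [← Real.rpow_natCast (2 * n : ℝ) n, ← Real.rpow_mul hx.le]
      have : (n : ℝ) * (2 + c * (1 / n)) = ((2 * n : ℕ) : ℝ) + c := by
        push_cast; field_simp
      rw [this, Real.rpow_add hx, Real.rpow_natCast]
    rw [hNpow] at key
    -- (1 + 1/(2n))^{2n} ≤ e ≤ (2n)^c
    have h1 : (1 + 1 / (2 * n : ℝ)) ^ (2 * n) ≤ Real.exp 1 := by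
      have hb : 1 + 1 / (2 * n : ℝ) ≤ Real.exp (1 / (2 * n)) := by
        have := Real.add_one_le_exp (1 / (2 * n : ℝ)); linarith
      calc (1 + 1 / (2 * n : ℝ)) ^ (2 * n) ≤ (Real.exp (1 / (2 * n))) ^ (2 * n) :=
            pow_le_pow_left₀ (by positivity) hb _
        _ = Real.exp 1 := by
            rw [← Real.exp_nat_mul]; congr 1; push_cast; field_simp
    have h2 : Real.exp 1 ≤ (2 * n : ℝ) ^ c := by
      rw [Real.rpow_def_of_pos hx, Real.exp_le_exp]
      have hlog : 1 / c ≤ Real.log (2 * n) := by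
        have h2n : Real.exp (1 / c) ≤ 2 * n := by linarith
        have := Real.log_le_log (Real.exp_pos _) h2n
        rwa [Real.log_exp] at this
      have := mul_le_mul_of_nonneg_left hlog hc.le
      rw [mul_one_div_cancel hc.ne'] at this
      rw [mul_comm] at this
      exact this
    have h3 : (2 * n + 1 : ℝ) ^ (2 * n) = (2 * n : ℝ) ^ (2 * n) * (1 + 1 / (2 * n : ℝ)) ^ (2 * n) := by
      rw [← mul_pow]; congr 1; field_simp
    have h4 : (2 * n + 1 : ℝ) ^ (2 * n + 1) ≤ (2 * n + 1 : ℝ) * ((2 * n : ℝ) ^ (2 * n) * (2 * n : ℝ) ^ c) := by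
      rw [pow_succ, mul_comm, h3]
      apply mul_le_mul_of_nonneg_left _ (by positivity)
      apply mul_le_mul_of_nonneg_left (h1.trans h2) (by positivity)
    push_cast at key
    linarith
  · -- N^a ≤ M
    push_cast
    rw [one_div, Real.pow_rpow_inv_natCast hx.le hn0]

end

end Summit.MatrixMultiplication.MatrixMultiplication.Theorems.RectangularThmB.Negative
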